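import Summits.Ventures.PercRepro.Night2LocalRuleFair

/-!
# PercRepro — two sufficient conditions for the fair-share certificate (night-2, gen 18)

Two ways to discharge the per-member inequality `dem B ≤ π B · fairIncome π B` of
`localShadowHall_of_fairShare` (`Night2LocalRuleFair.lean`) without touching the harmonic sum `fairIncome`:

* **pointwise** (`localShadowHall_of_uniform`): if the π-mass never exceeds the capacity, `piMass piDem S ≤ capS S`
  at every shadow set `S` — that is the column condition of the UNIFORM rule (every thin member spreads `dem B`
  equally over its `#supSets B` spanning supersets) — then every term `capS S / piMass piDem S` is `≥ 1`, so
  `fairIncome piDem B ≥ #supSets B` and (LI_G) holds;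
* **by Cauchy–Schwarz** (`localShadowHall_of_fairShare_jensen`): Sedrakyan's form
  `(Σ capS S)² / Σ capS S · piMass π S ≤ Σ capS S / piMass π S` (Mathlib's `Finset.sq_sum_div_le_sum_sq_div`)
  turns the per-member condition into the QUADRATIC inequality `dem B · capMass π B ≤ π B · capSum B ²`, where
  `capSum B = Σ_{S ⊇ B} capS S` and `capMass π B = Σ_{S ⊇ B} capS S · piMass π S`: the capacity-weighted
  average of the π-mass over the spanning supersets of `B` is at most `π B · capSum B / dem B`.
  Both use `capS S > 0` at every `S` when `|E ∖ G| ≤ q` (`capS_pos'`, the strict form of Lemma A).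
-/

namespace PercRepro.Shadow

open Finset PerFlat ThmH

variable {α : Type*} [DecidableEq α] {M : Matroid α} [M.Finite]

/-! ## The strict form of Lemma A -/

omit [DecidableEq α] [M.Finite] in
/-- `d · Φ < 1 + d` when `d ≤ q`. -/
theorem mul_phiQ_lt {q d : ℕ} (hd : d ≤ q) : (d : ℚ) * phiQ q < 1 + (d : ℚ) := by
  unfold phiQ
  have hq : (0 : ℚ) < (q : ℚ) + 1 := by positivity
  rw [mul_div_assoc', div_lt_iff₀ hq]
  have : (d : ℚ) ≤ (q : ℚ) := by exact_mod_cast hd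
  nlinarith

open scoped Classical in
/-- `capS S > 0` for every `S` when `|E ∖ G| ≤ q` (Lemma A, strict form). -/
theorem capS_pos' {q : ℕ} {G : Finset α} (hG : G ∈ flatsQ M (q + 1)) (hd : (gr M \ G).card ≤ q)
    (S : Finset α) : 0 < capS M q G S := by
  by_cases hS : S ⊆ G
  · unfold capS
    have hk : (k1 M q G S : ℚ) ≤ ((gr M \ G).card : ℚ) := by exact_mod_cast k1_le hG hS
    have hpos : (0 : ℚ) < 1 + ((gr M \ G).card : ℚ) := by positivity
    have h1 : ((gr M \ G).card : ℚ) * phiQ q < 1 + ((gr M \ G).card : ℚ) := mul_phiQ_lt hd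
    have h2 : (k1 M q G S : ℚ) * phiQ q ≤ ((gr M \ G).card : ℚ) * phiQ q :=
      mul_le_mul_of_nonneg_right hk (phiQ_pos q).le
    rw [sub_pos, div_lt_one hpos]
    exact h2.trans_lt h1
  · have hk : k1 M q G S = 0 := by
      unfold k1
      rw [Finset.card_eq_zero, Finset.filter_eq_empty_iff]
      intro B hB
      exact absurd (subset_of_coverPreimages_nonempty ⟨B, hB⟩) hS
    unfold capS
    rw [hk]
    simp

/-! ## The pointwise condition: the uniform rule -/

open scoped Classical in
/-- If the π-mass never exceeds the capacity on the spanning supersets of `B`, the fair-share income of `B`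
is at least its number of spanning supersets. -/
theorem card_supSets_le_fairIncome {q : ℕ} {G : Finset α} {π : Finset α → ℚ}
    (hπ : ∀ B ∈ thinMembers M q G, 0 < π B) {B : Finset α} (hB : B ∈ thinMembers M q G)
    (hpt : ∀ S ∈ supSets M q G B, piMass M q G π S ≤ capS M q G S) :
    ((supSets M q G B).card : ℚ) ≤ fairIncome M q G π B := by
  unfold fairIncome
  calc ((supSets M q G B).card : ℚ) = ∑ S ∈ supSets M q G B, (1 : ℚ) := by
        rw [Finset.sum_const, nsmul_eq_mul, mul_one]
    _ ≤ ∑ S ∈ supSets M q G B, capS M q G S / piMass M q G π S := by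
        apply Finset.sum_le_sum
        intro S hS
        have hPi : 0 < piMass M q G π S := piMass_pos hπ hB (mem_supSets.1 hS).2
        rw [le_div_iff₀ hPi, one_mul]
        exact hpt S hS

open scoped Classical in
/-- **The local form from the uniform rule.**  With `|E ∖ G| ≤ q`, if at every shadow set `S` the π-mass
`Σ_{B thin ⊆ S} dem B / #supSets B` is at most `capS S`, then (LI_G) holds at `G`. -/
theorem localShadowHall_of_uniform {q : ℕ} {G : Finset α} (hG : G ∈ flatsQ M (q + 1))
    (hd : (gr M \ G).card ≤ q)
    (hpt : ∀ S ∈ shadowAt M (q + 2) q (Uq M (q + 2) q) G,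
      piMass M q G (piDem M q G) S ≤ capS M q G S) :
    LocalShadowHall M q G := by
  apply localShadowHall_of_fairShare_dem hG hd
  intro B hB
  apply card_supSets_le_fairIncome (fun B' hB' => piDem_pos hG (mem_thinMembers.1 hB').1) hB
  intro S hS
  exact hpt S (mem_supSets.1 hS).1

/-! ## The Cauchy–Schwarz condition -/

/-- The total capacity of the spanning supersets of `B`. -/
noncomputable def capSum (M : Matroid α) [M.Finite] (q : ℕ) (G B : Finset α) : ℚ :=
  ∑ S ∈ supSets M q G B, capS M q G S

/-- The capacity-weighted π-mass around `B`: `Σ_{S ⊇ B} capS S · piMass π S`. -/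
noncomputable def capMass (M : Matroid α) [M.Finite] (q : ℕ) (G : Finset α) (π : Finset α → ℚ)
    (B : Finset α) : ℚ :=
  ∑ S ∈ supSets M q G B, capS M q G S * piMass M q G π S

open scoped Classical in
/-- The capacity-weighted π-mass around a thin member is positive. -/
theorem capMass_pos {q : ℕ} {G : Finset α} (hG : G ∈ flatsQ M (q + 1)) (hd : (gr M \ G).card ≤ q)
    {π : Finset α → ℚ} (hπ : ∀ B ∈ thinMembers M q G, 0 < π B) {B : Finset α}
    (hB : B ∈ thinMembers M q G) : 0 < capMass M q G π B := by
  unfold capMass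
  apply Finset.sum_pos
  · intro S hS
    exact mul_pos (capS_pos' hG hd S) (piMass_pos hπ hB (mem_supSets.1 hS).2)
  · exact supSets_nonempty hG (mem_thinMembers.1 hB).1

open scoped Classical in
/-- **Sedrakyan**: `capSum B ² / capMass π B ≤ fairIncome π B`. -/
theorem sq_capSum_div_le_fairIncome {q : ℕ} {G : Finset α} (hG : G ∈ flatsQ M (q + 1))
    (hd : (gr M \ G).card ≤ q) {π : Finset α → ℚ} (hπ : ∀ B ∈ thinMembers M q G, 0 < π B)
    {B : Finset α} (hB : B ∈ thinMembers M q G) :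
    capSum M q G B ^ 2 / capMass M q G π B ≤ fairIncome M q G π B := by
  unfold capSum capMass fairIncome
  have hg : ∀ S ∈ supSets M q G B, 0 < capS M q G S * piMass M q G π S :=
    fun S hS => mul_pos (capS_pos' hG hd S) (piMass_pos hπ hB (mem_supSets.1 hS).2)
  refine (Finset.sq_sum_div_le_sum_sq_div (supSets M q G B) (fun S => capS M q G S) hg).trans
    (le_of_eq ?_)
  apply Finset.sum_congr rfl
  intro S _
  have hc : capS M q G S ≠ 0 := (capS_pos' hG hd S).ne'
  rw [sq, mul_div_mul_left _ _ hc]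

open scoped Classical in
/-- **The local form from the Cauchy–Schwarz form of the fair-share condition.**  With `|E ∖ G| ≤ q` and a
positive weight `π`, if every thin member `B` satisfies `dem B · capMass π B ≤ π B · capSum B ²`, then
(LI_G) holds at `G`. -/
theorem localShadowHall_of_fairShare_jensen {q : ℕ} {G : Finset α} (hG : G ∈ flatsQ M (q + 1))
    (hd : (gr M \ G).card ≤ q) (π : Finset α → ℚ) (hπ : ∀ B ∈ thinMembers M q G, 0 < π B)
    (hcond : ∀ B ∈ thinMembers M q G,
      dem M q G B * capMass M q G π B ≤ π B * capSum M q G B ^ 2) :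
    LocalShadowHall M q G := by
  apply localShadowHall_of_fairShare hG hd π hπ
  intro B hB
  have hM : 0 < capMass M q G π B := capMass_pos hG hd hπ hB
  have h1 := sq_capSum_div_le_fairIncome hG hd hπ hB
  have h2 : dem M q G B ≤ π B * (capSum M q G B ^ 2 / capMass M q G π B) := by
    rw [mul_div_assoc', le_div_iff₀ hM]
    exact hcond B hB
  exact h2.trans (mul_le_mul_of_nonneg_left h1 (hπ B hB).le)

end PercRepro.Shadow
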